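import Summits.NavierStokesRegularity.NavierStokesRegularity.Theorems.TaoLadderRungTwoFlatHopInvariant
import HarnessLib

/-!
# HOP-INVARIANT-50, part 2 — every tube state is sup-bounded; statics of the tube from the schedule
  (cell harvest/h2-tao-ladder, theory-1 g38, numT50/HopInvariant50.lean sha16 1bc3dc6f836c89b6, second half, landed by
  p1 g21 with decls byte-identical; helper for item stmt-NavierStokesRegularity-23909 `GradedAdiabaticWake`)

* `geomGauge_lower`, `inTube_bounded` — sanity: every tube state of `…HopInvariant.InTube` is sup-bounded (the
  format's (4.5) at `s = 0` is not violated by the description; the behind cap `min(|k|, n + K₂)` is what makes this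
  true for `n > N₀`);
* `tailClause_of_inTube`, `abs_le_of_inTube`, `tubeStatics_of_schedule` — `TailFat` / `TameBehind` / `TailCompat`
  of `tubeSet` are weight algebra + the clauses + uniform schedule sups (`TubeStatics` DISCHARGED from the schedule).

HONEST FRAMING: MODEL lattice (graded mirror table on `S♭`); bookkeeping about the SHAPE of an induction hypothesis;
nothing certified; nothing about the Navier–Stokes equations.
-/

noncomputable section

set_option linter.dupNamespace false

namespace Summit.NavierStokesRegularity.NavierStokesRegularity.Theorems.HopInvariant

open Set Finset Literature.Analysis.FluidPDE Literature.Analysis.FluidPDE.TaoCascade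

/-! ## Sanity: every tube state is sup-bounded (the format's (4.5) at `s = 0` is not violated by the description) -/

/-- The gauge `geomGauge g b` (`g, b ≥ 1`) is bounded below by `(b^K)⁻¹` on the half-line `k ≥ -K`.
[cite: Tao2016AveragedNS, §6.3 (weighted norms, statement shape); cell SPLIT-T47 gauge] -/
theorem geomGauge_lower {g b : ℝ} (hg : 1 ≤ g) (hb : 1 ≤ b) (K : ℕ) (i : Fin 2) {k : ℤ} (hk : -(K : ℤ) ≤ k) :
    (b ^ K)⁻¹ ≤ MirrorPulse.geomGauge g b i k := by
  unfold MirrorPulse.geomGauge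
  have hbK : 1 ≤ b ^ K := one_le_pow₀ hb
  by_cases h0 : 0 ≤ k
  · have h1 : (-k).toNat = 0 := Int.toNat_eq_zero.mpr (by omega)
    rw [h1, pow_zero, inv_one, mul_one]
    exact (inv_le_one_of_one_le₀ hbK).trans (one_le_pow₀ hg)
  · have h1 : k.toNat = 0 := Int.toNat_eq_zero.mpr (by omega)
    have h2 : (-k).toNat ≤ K := by omega
    rw [h1, pow_zero, one_mul]
    exact inv_anti₀ (pow_pos (by linarith) _) (pow_le_pow_right₀ hb h2)

/-- **Every tube state is sup-bounded** (given bounded capture centres and a bounded section state on the window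
half-line): the behind cap `min(|k|, n + K₂)` is what makes this true for `n > N₀`. Exact format flows
(`PseudoFlowOnShift`, clause (4.5)) start only from such states, so without the cap `TubeExist` would be unsatisfiable.
[cite: Tao2016AveragedNS, §4 Lemma 4.1 (4.5); cell LADDER §50] -/
theorem inTube_bounded (P : TubeSchedule) {ε₀ : ℝ} {i₀ : Fin 2} {X₀ : Fin 2 → ℝ} {w : ℤ → ℝ} {r : ℝ}
    {ζ : ℕ → Fin 2 → ℤ → ℝ} {ustar : Fin 2 → ℤ → ℝ} {n : ℕ} {z : Fin 2 → ℤ → ℝ}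
    (hg : 1 ≤ P.g) (hb : 1 ≤ P.b) (hε : 0 ≤ ε₀) (hθb : 0 ≤ P.θb)
    (hζ : ∃ M, ∀ i k, |ζ n i k| ≤ M) (hu : ∃ M, ∀ i k, -(P.K : ℤ) ≤ k → |ustar i k| ≤ M)
    (hz : InTube P ε₀ i₀ X₀ w r ζ ustar n z) : ∃ M, ∀ i k, |z i k| ≤ M := by
  by_cases h0 : n = 0
  · simp only [InTube, h0, if_true] at hz
    subst hz
    refine ⟨(|X₀ 0| + |X₀ 1|) / |X₀ i₀|, fun i k => ?_⟩
    simp only [datumState]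
    rw [abs_div, abs_abs]
    refine div_le_div_of_nonneg_right ?_ (abs_nonneg _)
    fin_cases i <;> split_ifs <;> simp <;> positivity
  by_cases h1 : n ≤ P.N₀
  · simp only [InTube, h0, if_false, if_pos h1] at hz
    obtain ⟨M, hM⟩ := hζ
    refine ⟨M + P.η n, fun i k => ?_⟩
    have h2 := hz.1 i k
    have h3 := hM i k
    have h4 := abs_sub_abs_le_abs_sub (z i k) (ζ n i k)
    linarith
  · simp only [InTube, h0, if_false, if_neg h1] at hz
    obtain ⟨-, hcore, -, hbehind, -⟩ := hz
    obtain ⟨Mu, hMu⟩ := hu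
    refine ⟨max (Mu + P.δ n * P.b ^ P.K) (P.A n * (1 + ε₀) ^ (P.θb * ((n : ℝ) + P.K₂))), ?_⟩
    intro i k
    by_cases hk : k < -(P.K : ℤ)
    · -- behind the window: the capped envelope
      refine (hbehind i k hk).trans (?_ : _ ≤ _) |>.trans (le_max_right _ _)
      have hmin : P.θb * min |(k : ℝ)| ((n : ℝ) + P.K₂) ≤ P.θb * ((n : ℝ) + P.K₂) :=
        mul_le_mul_of_nonneg_left (min_le_right _ _) hθb
      have hA : 0 ≤ P.A n := by
        have := (abs_nonneg (z i k)).trans (hbehind i k hk)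
        have hpos : 0 < (1 + ε₀) ^ (P.θb * min |(k : ℝ)| ((n : ℝ) + P.K₂)) := Real.rpow_pos_of_pos (by linarith) _
        nlinarith [this, hpos]  -- A n * pos ≥ 0 ⇒ A n ≥ 0
      exact mul_le_mul_of_nonneg_left (Real.rpow_le_rpow_of_exponent_le (by linarith) hmin) hA
    · -- on the window half-line: gauge tube around `u⋆`
      rw [not_lt] at hk
      have hG := geomGauge_lower hg hb P.K i hk
      have hc := hcore i k hk
      have hbK : 0 < P.b ^ P.K := pow_pos (by linarith) _
      have hδ : |z i k - ustar i k| ≤ P.δ n * P.b ^ P.K := by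
        have h5 : (P.b ^ P.K)⁻¹ * |z i k - ustar i k| ≤ P.δ n :=
          (mul_le_mul_of_nonneg_right hG (abs_nonneg _)).trans hc
        rwa [inv_mul_le_iff₀ hbK, mul_comm] at h5
      have h4 := abs_sub_abs_le_abs_sub (z i k) (ustar i k)
      exact (by linarith [hMu i k hk] : |z i k| ≤ Mu + P.δ n * P.b ^ P.K).trans (le_max_left _ _)


/-! ## Statics of the tube from the schedule: `TailFat` / `TameBehind` / `TailCompat` are weight algebra + the clauses -/

section Statics

variable (P : TubeSchedule) {ε₀ : ℝ} {i₀ : Fin 2} {X₀ : Fin 2 → ℝ} {w : ℤ → ℝ} {r : ℝ}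
  {ζ : ℕ → Fin 2 → ℤ → ℝ} {ustar : Fin 2 → ℤ → ℝ}

/-- Ahead of shell `k₁ ≥ 1` every tube state satisfies the `TailFat` state clause `4·w_k|z_k| ≤ r` (datum: zero there;
capture and tube states: the ahead clause with margin `8`). [cite: Tao2016AveragedNS, §6.2 Prop. 6.3 (ix); cell LADDER §50] -/
theorem tailClause_of_inTube (hk₁ : 1 ≤ P.k₁) (hr : 0 ≤ r) (hw : ∀ k, 0 ≤ w k) {n : ℕ} {z : Fin 2 → ℤ → ℝ}
    (hz : InTube P ε₀ i₀ X₀ w r ζ ustar n z) {k : ℤ} (hk : (P.k₁ : ℤ) ≤ k) (i : Fin 2) :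
    4 * (w k * |z i k|) ≤ r := by
  have hAhead : ∀ {z : Fin 2 → ℤ → ℝ}, AheadClause P w r z → 4 * (w k * |z i k|) ≤ r := by
    intro z h
    have h8 := h i k hk
    have h0 : 0 ≤ w k * |z i k| := mul_nonneg (hw k) (abs_nonneg _)
    linarith
  by_cases h0 : n = 0
  · simp only [InTube, h0, if_true] at hz
    subst hz
    have hk0 : k ≠ 0 := by omega
    simp [datumState, hk0, hr]
  by_cases h1 : n ≤ P.N₀
  · simp only [InTube, h0, if_false, if_pos h1] at hz
    exact hAhead hz.2
  · simp only [InTube, h0, if_false, if_neg h1] at hz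
    exact hAhead hz.2.2.2.2

/-- Uniform behind-tame bound of every tube state: `|z i k| ≤ B₀·(1 + (1+ε₀)^{-k})` with `B₀` explicit in the schedule sups
(datum bound + capture bound + window bound + behind envelope constant). [cite: Tao2016AveragedNS, §6.3–6.4; cell LADDER §50] -/
theorem abs_le_of_inTube (hg : 1 ≤ P.g) (hb : 1 ≤ P.b) (hε : 0 ≤ ε₀) (hθb1 : P.θb ≤ 1)
    {Abar δbar ηbar Mζ Mu : ℝ} (hA : ∀ n, 0 ≤ P.A n ∧ P.A n ≤ Abar) (hδ : ∀ n, P.δ n ≤ δbar) (hδ0 : 0 ≤ δbar)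
    (hη : ∀ n, P.η n ≤ ηbar) (hη0 : 0 ≤ ηbar) (hζ : ∀ n i k, |ζ n i k| ≤ Mζ)
    (hu : ∀ i k, -(P.K : ℤ) ≤ k → |ustar i k| ≤ Mu) (hMu : 0 ≤ Mu)
    {n : ℕ} {z : Fin 2 → ℤ → ℝ} (hz : InTube P ε₀ i₀ X₀ w r ζ ustar n z) (i : Fin 2) (k : ℤ) :
    |z i k| ≤ ((|X₀ 0| + |X₀ 1|) / |X₀ i₀| + (Mζ + ηbar) + (Mu + δbar * P.b ^ P.K) + Abar) *
      (1 + (1 + ε₀) ^ (-(k : ℝ))) := by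
  set B₀ := (|X₀ 0| + |X₀ 1|) / |X₀ i₀| + (Mζ + ηbar) + (Mu + δbar * P.b ^ P.K) + Abar with hB₀
  have hMζ : 0 ≤ Mζ := (abs_nonneg _).trans (hζ 0 0 0)
  have hAbar : 0 ≤ Abar := (hA 0).1.trans (hA 0).2
  have hCd : 0 ≤ (|X₀ 0| + |X₀ 1|) / |X₀ i₀| := by positivity
  have hbK : 0 ≤ δbar * P.b ^ P.K := mul_nonneg hδ0 (pow_nonneg (by linarith) _)
  have hpow : 0 < (1 + ε₀) ^ (-(k : ℝ)) := Real.rpow_pos_of_pos (by linarith) _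
  have hB₀0 : 0 ≤ B₀ := by rw [hB₀]; linarith
  have key : ∀ T : ℝ, |z i k| ≤ T → T ≤ B₀ → |z i k| ≤ B₀ * (1 + (1 + ε₀) ^ (-(k : ℝ))) := by
    intro T h1 h2
    have : B₀ ≤ B₀ * (1 + (1 + ε₀) ^ (-(k : ℝ))) := by nlinarith [mul_nonneg hB₀0 hpow.le]
    linarith
  by_cases h0 : n = 0
  · simp only [InTube, h0, if_true] at hz
    subst hz
    refine key ((|X₀ 0| + |X₀ 1|) / |X₀ i₀|) ?_ (by rw [hB₀]; linarith)
    simp only [datumState]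
    rw [abs_div, abs_abs]
    refine div_le_div_of_nonneg_right ?_ (abs_nonneg _)
    fin_cases i <;> split_ifs <;> simp <;> positivity
  by_cases h1 : n ≤ P.N₀
  · simp only [InTube, h0, if_false, if_pos h1] at hz
    refine key (Mζ + ηbar) ?_ (by rw [hB₀]; linarith)
    have h2 := hz.1 i k
    have h3 := hζ n i k
    have h4 := abs_sub_abs_le_abs_sub (z i k) (ζ n i k)
    linarith [hη n]
  · simp only [InTube, h0, if_false, if_neg h1] at hz
    obtain ⟨-, hcore, -, hbehind, -⟩ := hz
    by_cases hk : k < -(P.K : ℤ)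
    · -- behind the window: envelope ≤ Abar·(1+ε₀)^{-k}
      have hkR : |(k : ℝ)| = -(k : ℝ) := by
        have : (k : ℝ) < 0 := by exact_mod_cast (by omega : k < 0)
        exact abs_of_neg this
      have hexp : P.θb * min |(k : ℝ)| ((n : ℝ) + P.K₂) ≤ -(k : ℝ) := by
        have hmin : min |(k : ℝ)| ((n : ℝ) + P.K₂) ≤ |(k : ℝ)| := min_le_left _ _
        have hmin0 : 0 ≤ min |(k : ℝ)| ((n : ℝ) + P.K₂) := le_min (abs_nonneg _) (by positivity)
        calc P.θb * min |(k : ℝ)| ((n : ℝ) + P.K₂) ≤ 1 * |(k : ℝ)| := mul_le_mul hθb1 hmin hmin0 zero_le_one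
          _ = -(k : ℝ) := by rw [one_mul, hkR]
      have h5 : (1 + ε₀) ^ (P.θb * min |(k : ℝ)| ((n : ℝ) + P.K₂)) ≤ (1 + ε₀) ^ (-(k : ℝ)) :=
        Real.rpow_le_rpow_of_exponent_le (by linarith) hexp
      have h6 := hbehind i k hk
      have h7 : P.A n * (1 + ε₀) ^ (P.θb * min |(k : ℝ)| ((n : ℝ) + P.K₂)) ≤ Abar * (1 + ε₀) ^ (-(k : ℝ)) :=
        mul_le_mul (hA n).2 h5 (Real.rpow_pos_of_pos (by linarith) _).le hAbar
      have hAB : Abar ≤ B₀ := by rw [hB₀]; linarith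
      have h8 : Abar * (1 + ε₀) ^ (-(k : ℝ)) ≤ B₀ * (1 + (1 + ε₀) ^ (-(k : ℝ))) := by
        nlinarith [mul_le_mul_of_nonneg_right hAB hpow.le]
      linarith
    · rw [not_lt] at hk
      refine key (Mu + δbar * P.b ^ P.K) ?_ (by rw [hB₀]; linarith)
      have hG := geomGauge_lower hg hb P.K i hk
      have hc := hcore i k hk
      have hbK' : 0 < P.b ^ P.K := pow_pos (by linarith) _
      have hδ' : |z i k - ustar i k| ≤ P.δ n * P.b ^ P.K := by
        have h5 : (P.b ^ P.K)⁻¹ * |z i k - ustar i k| ≤ P.δ n :=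
          (mul_le_mul_of_nonneg_right hG (abs_nonneg _)).trans hc
        rwa [inv_mul_le_iff₀ hbK', mul_comm] at h5
      have hδn : P.δ n * P.b ^ P.K ≤ δbar * P.b ^ P.K := mul_le_mul_of_nonneg_right (hδ n) hbK'.le
      have h4 := abs_sub_abs_le_abs_sub (z i k) (ustar i k)
      linarith [hu i k hk]

/-- **STATICS OF THE TUBE FROM THE SCHEDULE** (`TubeStatics` discharged): the signs and margins, weights `≥ 1`, and the
three static format clauses `TailFat` / `TameBehind` / `TailCompat` for `Z := tubeSet` follow from the weight algebra
(`w` doubling-fast beyond `k₁ ≥ 1`, `w_k ≤ C_w(1+ε₀)^{|k|}` behind, the envelope and hand-over inequalities beyond `k₁`)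
and uniform sups of the schedule (`A n ≤ Ā`, `δ n ≤ δ̄`, `η n ≤ η̄`, bounded capture centres, `u⋆` bounded on `k ≥ −K`).
[cite: Tao2016AveragedNS, §6.2 Prop. 6.3 (ix), §6.3–6.4; cell LADDER §47.5 L1, §50] -/
theorem tubeStatics_of_schedule {σ θ₀ θ c₀ c : ℝ} {env₀ : ℤ → ℝ}
    (hr : 0 < r) (hθ0 : 0 ≤ θ₀) (hθ : θ₀ < θ) (hθh : θ ≤ 1 / 2) (hc0 : 0 < c₀) (hc : c₀ < c) (hσ : 0 < σ)
    (hw : ∀ k, 1 ≤ w k) (hk₁ : 1 ≤ P.k₁)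
    (hgrow : ∀ k : ℤ, (P.k₁ : ℤ) ≤ k → 2 * (1 + ε₀) ^ (k : ℝ) * w k ≤ w (k + 1))
    {K₀ C₄ : ℝ} (henv : ∀ k : ℤ, (P.k₁ : ℤ) ≤ k → env₀ k ≤ K₀ * r ^ 2 / w (k - 1) ^ 2)
    (hC4 : ∀ k : ℤ, (P.k₁ : ℤ) ≤ k → (1 + ε₀) ^ ((5 : ℝ) * (k + 2) / 2) * r * w (k + 1) ≤ C₄ * w k ^ 2)
    {Cw : ℝ} (hwB : ∀ k : ℤ, k ≤ 0 → w k ≤ Cw * (1 + ε₀) ^ (-(k : ℝ)))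
    (hg : 1 ≤ P.g) (hb : 1 ≤ P.b) (hε : 0 ≤ ε₀) (hθb1 : P.θb ≤ 1)
    {Abar δbar ηbar Mζ Mu : ℝ} (hA : ∀ n, 0 ≤ P.A n ∧ P.A n ≤ Abar) (hδ : ∀ n, P.δ n ≤ δbar) (hδ0 : 0 ≤ δbar)
    (hη : ∀ n, P.η n ≤ ηbar) (hη0 : 0 ≤ ηbar) (hζ : ∀ n i k, |ζ n i k| ≤ Mζ)
    (hu : ∀ i k, -(P.K : ℤ) ≤ k → |ustar i k| ≤ Mu) (hMu : 0 ≤ Mu) :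
    TubeStatics P σ ε₀ i₀ X₀ w r θ₀ c₀ env₀ ζ ustar θ c := by
  have hw0 : ∀ k, 0 ≤ w k := fun k => zero_le_one.trans (hw k)
  have htail : ∀ k : ℤ, (P.k₁ : ℤ) ≤ k → ∀ z ∈ tubeSet P ε₀ i₀ X₀ w r ζ ustar, ∀ i : Fin 2,
      4 * (w k * |z i k|) ≤ r := by
    intro k hk z hz i
    obtain ⟨n, hn⟩ := hz
    exact tailClause_of_inTube P hk₁ hr.le hw0 hn hk i
  refine ⟨hr, hθ0, hθ, hθh, hc0, hc, hσ, hw, ?_, ?_, ?_⟩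
  · exact ⟨P.k₁, fun k hk => ⟨hgrow k hk, htail k hk⟩⟩
  · refine ⟨max ((|X₀ 0| + |X₀ 1|) / |X₀ i₀| + (Mζ + ηbar) + (Mu + δbar * P.b ^ P.K) + Abar) Cw, ?_, ?_⟩
    · intro z hz i k
      obtain ⟨n, hn⟩ := hz
      have h := abs_le_of_inTube P hg hb hε hθb1 hA hδ hδ0 hη hη0 hζ hu hMu hn i k
      have hpos : 0 ≤ 1 + (1 + ε₀) ^ (-(k : ℝ)) := by
        have := Real.rpow_pos_of_pos (by linarith : (0 : ℝ) < 1 + ε₀) (-(k : ℝ)); linarith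
      exact h.trans (mul_le_mul_of_nonneg_right (le_max_left _ _) hpos)
    · intro k hk
      have hpos : 0 ≤ (1 + ε₀) ^ (-(k : ℝ)) := (Real.rpow_pos_of_pos (by linarith : (0 : ℝ) < 1 + ε₀) _).le
      exact (hwB k hk).trans (mul_le_mul_of_nonneg_right (le_max_right _ _) hpos)
  · exact ⟨P.k₁, K₀, C₄, fun k hk => ⟨hgrow k hk, htail k hk, henv k hk, hC4 k hk⟩⟩

end Statics

end Summit.NavierStokesRegularity.NavierStokesRegularity.Theorems.HopInvariant

end
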